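import Summits.HubbardSuperconductivity.HubbardSuperconductivity.Theorems.AnisotropyChordTransferTwoMagnon

/-!
# Route `AnisotropyChord` / H0 rotor rung: lemmas for the XY-point two-magnon SCREENING INEQUALITY (part 1 of 2)

Bookkeeping for the proof of the tree's conjecture-tagged `XYTwoMagnonScreening` (PART N20, `…TransferTwoMagnon`;
memo ROTOR-THEORY-18 §219(d)/§220 of the theory seat `hubbard-h0-rotor-theory-1`), completed in part 2
(`…TransferTwoMagnonScreening`, `xyTwoMagnonScreening_holds`).  With `θ = π/L`, `c = cos θ`:
* `screenS L j = 2(1 − cos(2πj/L)) = 4 sin²(jθ)` (the `K = 0` x-energies) and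
  `screenP L j = 2c(c − cos((2j+1)θ)) = 4c·sin(jθ)·sin((j+1)θ)` (the `K₁` x-energies), their zeros
  (`S_0 = P_0 = P_{L−1} = 0`), symmetries (`S_{L−1} = S_1`, `S_{L−2} = S_2 = 4c²S_1`), signs, `S_1 ≤ S_k`;
* the PAIRING inequalities `c·S_j ≤ P_j` (`2j+1 ≤ L`) and `c·S_{j+1} ≤ P_j` (`L ≤ 2j+1`) from
  `sin((j+1)θ) − sin(jθ) = 2 sin(θ/2)·cos((2j+1)θ/2)`;
* `4/5 ≤ cos(π/L)` for `L ≥ 5`; the termwise bound `1/(λx − τ) ≤ (m/(λm − τ))·(1/x)` for `x ≥ m`;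
* `gZero L 0 = L⁻²·screenG0 L`, `gOne L t = L⁻²·screenG1 L t` (by `rfl`) and the row decompositions
  `screenG0 (n+2) = R + Σ_{j=1}^{n+1} (1/S_j + B_j)`, `screenG1 (n+2) τ = 2R'(τ) + Σ_{j=1}^{n} T_j(τ)`.

Prover seat `hubbard-h0-rotor-p1` g21; helper for the H0 rotor rung dossier of stmt-HubbardSuperconductivity-19089
(`--supports`).  No definition of the route is touched; nothing here is a statement about the Hubbard model.
-/

set_option linter.dupNamespace false
set_option autoImplicit false

noncomputable section

open Finset Real

namespace Summit.HubbardSuperconductivity.HubbardSuperconductivity.Theorems.AnisotropyChord.Transfer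

/-! ## The `K = 0` and `K₁` x-energies -/

/-- `S_j = 2(1 − cos(2πj/L))`, the `K = 0` one-direction two-magnon kinetic energy (`= 4 sin²(jπ/L)`). [folklore] -/
def screenS (L : ℕ) (j : ℕ) : ℝ := 2 * (1 - Real.cos (2 * Real.pi * j / L))

/-- `P_j = 2c(c − cos((2j+1)π/L))`, `c = cos(π/L)`, the `K₁` x-kinetic energy above its bottom
(`= 4c·sin(jπ/L)·sin((j+1)π/L)`). [folklore] -/
def screenP (L : ℕ) (j : ℕ) : ℝ :=
  2 * Real.cos (Real.pi / L) * (Real.cos (Real.pi / L) - Real.cos ((2 * j + 1) * Real.pi / L))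

/-- `S_j = 4 sin²(jπ/L)`. [folklore] -/
theorem screenS_eq_sin (L j : ℕ) : screenS L j = 4 * Real.sin (Real.pi * j / L) ^ 2 := by
  unfold screenS
  rw [Real.sin_sq_eq_half_sub]
  have : 2 * (Real.pi * j / L) = 2 * Real.pi * j / L := by ring
  rw [this]; ring

/-- `P_j = 4c·sin(jπ/L)·sin((j+1)π/L)`. [folklore] -/
theorem screenP_eq_sin (L j : ℕ) :
    screenP L j = 4 * Real.cos (Real.pi / L) * Real.sin (Real.pi * j / L) * Real.sin (Real.pi * (j + 1) / L) := by
  unfold screenP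
  have h := Real.cos_sub_cos (Real.pi / L) ((2 * j + 1) * Real.pi / L)
  have e1 : (Real.pi / L + (2 * j + 1) * Real.pi / L) / 2 = Real.pi * (j + 1) / L := by ring
  have e2 : (Real.pi / L - (2 * j + 1) * Real.pi / L) / 2 = -(Real.pi * j / L) := by ring
  rw [e1, e2, Real.sin_neg] at h
  rw [h]; ring

/-- `S_0 = 0`. [folklore] -/
theorem screenS_zero (L : ℕ) : screenS L 0 = 0 := by
  simp [screenS]

/-- `P_0 = 0`. [folklore] -/
theorem screenP_zero (L : ℕ) : screenP L 0 = 0 := by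
  rw [screenP_eq_sin]; simp

/-- `P_{L−1} = 0` (written with `L = n + 2`). [folklore] -/
theorem screenP_last (n : ℕ) : screenP (n + 2) (n + 1) = 0 := by
  rw [screenP_eq_sin]
  have : Real.pi * ((((n + 1 : ℕ) : ℝ)) + 1) / ((n + 2 : ℕ) : ℝ) = Real.pi := by
    have h : ((n + 2 : ℕ) : ℝ) ≠ 0 := by positivity
    field_simp
    push_cast
    ring
  rw [this, Real.sin_pi]; ring

/-- `S_{L−1} = S_1` (written with `L = n + 2`). [folklore] -/
theorem screenS_last (n : ℕ) : screenS (n + 2) (n + 1) = screenS (n + 2) 1 := by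
  unfold screenS
  have : 2 * Real.pi * ((n + 1 : ℕ) : ℝ) / ((n + 2 : ℕ) : ℝ) = 2 * Real.pi - 2 * Real.pi * ((1 : ℕ) : ℝ) / ((n + 2 : ℕ) : ℝ) := by
    push_cast
    field_simp
    ring
  rw [this, Real.cos_two_pi_sub]

/-- `S_{L−2} = S_2` (written with `L = n + 2`). [folklore] -/
theorem screenS_lastButOne (n : ℕ) : screenS (n + 2) n = screenS (n + 2) 2 := by
  unfold screenS
  have : 2 * Real.pi * ((n : ℕ) : ℝ) / ((n + 2 : ℕ) : ℝ) = 2 * Real.pi - 2 * Real.pi * ((2 : ℕ) : ℝ) / ((n + 2 : ℕ) : ℝ) := by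
    push_cast
    field_simp
    ring
  rw [this, Real.cos_two_pi_sub]

/-- `S_2 = 4 cos²(π/L) · S_1`. [folklore] -/
theorem screenS_two (L : ℕ) : screenS L 2 = 4 * Real.cos (Real.pi / L) ^ 2 * screenS L 1 := by
  unfold screenS
  have e4 : 2 * Real.pi * ((2 : ℕ) : ℝ) / (L : ℝ) = 2 * (2 * (Real.pi / L)) := by push_cast; ring
  have e2 : 2 * Real.pi * ((1 : ℕ) : ℝ) / (L : ℝ) = 2 * (Real.pi / L) := by push_cast; ring
  rw [e4, e2, Real.cos_two_mul (2 * (Real.pi / L)), Real.cos_two_mul (Real.pi / L)]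
  ring


/-! ## Signs and monotonicity -/

/-- `0 < sin(πj/L)` for `1 ≤ j ≤ L − 1`. [folklore] -/
theorem screen_sin_pos {L j : ℕ} (hj : 1 ≤ j) (hjL : j + 1 ≤ L) : 0 < Real.sin (Real.pi * j / L) := by
  have hL : (0 : ℝ) < L := by exact_mod_cast (show 0 < L by omega)
  have hj' : (1 : ℝ) ≤ j := by exact_mod_cast hj
  have hjL' : (j : ℝ) + 1 ≤ L := by exact_mod_cast hjL
  apply Real.sin_pos_of_pos_of_lt_pi
  · have := Real.pi_pos; positivity
  · rw [div_lt_iff₀ hL]; nlinarith [Real.pi_pos]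

/-- `0 ≤ sin(πj/L)` for `j ≤ L`. [folklore] -/
theorem screen_sin_nonneg {L j : ℕ} (hjL : j ≤ L) : 0 ≤ Real.sin (Real.pi * j / L) := by
  rcases Nat.eq_zero_or_pos L with h | hL
  · subst h; simp
  have hL' : (0 : ℝ) < L := by exact_mod_cast hL
  have hjL' : (j : ℝ) ≤ L := by exact_mod_cast hjL
  apply Real.sin_nonneg_of_nonneg_of_le_pi
  · have := Real.pi_pos; positivity
  · rw [div_le_iff₀ hL']; nlinarith [Real.pi_pos]

/-- `0 ≤ S_j`. [folklore] -/
theorem screenS_nonneg (L j : ℕ) : 0 ≤ screenS L j := by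
  rw [screenS_eq_sin]; positivity

/-- `0 < S_j` for `1 ≤ j ≤ L − 1`. [folklore] -/
theorem screenS_pos {L j : ℕ} (hj : 1 ≤ j) (hjL : j + 1 ≤ L) : 0 < screenS L j := by
  rw [screenS_eq_sin]
  have := screen_sin_pos hj hjL
  positivity

/-- `S_1 ≤ S_k` for `1 ≤ k ≤ L − 1` (`cos(2πk/L) ≤ cos(2π/L)`). [folklore] -/
theorem screenS_one_le {L k : ℕ} (hk : 1 ≤ k) (hkL : k + 1 ≤ L) : screenS L 1 ≤ screenS L k := by
  unfold screenS
  have hL : (0 : ℝ) < L := by exact_mod_cast (show 0 < L by omega)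
  have hk' : (1 : ℝ) ≤ k := by exact_mod_cast hk
  have hkL' : (k : ℝ) + 1 ≤ L := by exact_mod_cast hkL
  have hpi := Real.pi_pos
  have h1 : (0 : ℝ) ≤ 2 * Real.pi * ((1 : ℕ) : ℝ) / L := by positivity
  suffices h : Real.cos (2 * Real.pi * k / L) ≤ Real.cos (2 * Real.pi * ((1 : ℕ) : ℝ) / L) by linarith
  by_cases hcase : 2 * k ≤ L
  · have hcase' : 2 * (k : ℝ) ≤ L := by exact_mod_cast hcase
    apply Real.cos_le_cos_of_nonneg_of_le_pi h1
    · rw [div_le_iff₀ hL]; nlinarith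
    · push_cast; gcongr
  · rw [not_le] at hcase
    have hcase' : (L : ℝ) < 2 * k := by exact_mod_cast hcase
    rw [← Real.cos_two_pi_sub]
    apply Real.cos_le_cos_of_nonneg_of_le_pi h1
    · rw [sub_le_iff_le_add]
      have : Real.pi ≤ 2 * Real.pi * k / L := by
        rw [le_div_iff₀ hL]; nlinarith
      linarith
    · push_cast
      rw [le_sub_iff_add_le, ← add_div, div_le_iff₀ hL]
      nlinarith

/-- `0 ≤ cos(π/L) ≤ 1` for `L ≥ 2`. [folklore] -/
theorem screen_cos_nonneg {L : ℕ} (hL : 2 ≤ L) : 0 ≤ Real.cos (Real.pi / L) := by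
  have hL' : (2 : ℝ) ≤ L := by exact_mod_cast hL
  have hpi := Real.pi_pos
  apply Real.cos_nonneg_of_neg_pi_div_two_le_of_le
  · have : (0 : ℝ) ≤ Real.pi / L := by positivity
    linarith
  · rw [div_le_div_iff_of_pos_left hpi (by linarith) (by norm_num)]; exact hL'

/-- `4/5 ≤ cos(π/L)` for `L ≥ 5` (`cos x ≥ 1 − x²/2`, `π < 3.15`). [folklore] -/
theorem screen_cos_ge {L : ℕ} (hL : 5 ≤ L) : 4 / 5 ≤ Real.cos (Real.pi / L) := by
  have hL' : (5 : ℝ) ≤ L := by exact_mod_cast hL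
  have hpi := Real.pi_pos
  have hpi' := Real.pi_lt_d2
  have h := Real.one_sub_sq_div_two_le_cos (x := Real.pi / L)
  have hx : Real.pi / L ≤ 3.15 / 5 := by
    rw [div_le_div_iff₀ (by linarith) (by norm_num)]; nlinarith
  have hx0 : 0 ≤ Real.pi / L := by positivity
  nlinarith

/-- the pairing step, ascending half: `sin(πj/L) ≤ sin(π(j+1)/L)` when `2j + 1 ≤ L`. [folklore] -/
theorem screen_sin_step_le {L j : ℕ} (hL : 1 ≤ L) (h : 2 * j + 1 ≤ L) :
    Real.sin (Real.pi * j / L) ≤ Real.sin (Real.pi * (j + 1) / L) := by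
  have hL' : (0 : ℝ) < L := by exact_mod_cast (show 0 < L by omega)
  have h' : 2 * (j : ℝ) + 1 ≤ L := by exact_mod_cast h
  have hpi := Real.pi_pos
  have hs := Real.sin_sub_sin (Real.pi * (j + 1) / L) (Real.pi * j / L)
  have e1 : (Real.pi * (j + 1) / L - Real.pi * j / L) / 2 = Real.pi / (2 * L) := by field_simp; ring
  have e2 : (Real.pi * (j + 1) / L + Real.pi * j / L) / 2 = (2 * j + 1) * Real.pi / (2 * L) := by field_simp; ring
  rw [e1, e2] at hs
  have hA : 0 ≤ Real.sin (Real.pi / (2 * L)) := by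
    apply Real.sin_nonneg_of_nonneg_of_le_pi
    · positivity
    · rw [div_le_iff₀ (by positivity)]; nlinarith
  have hB : 0 ≤ Real.cos ((2 * j + 1) * Real.pi / (2 * L)) := by
    apply Real.cos_nonneg_of_neg_pi_div_two_le_of_le
    · have : (0 : ℝ) ≤ (2 * j + 1) * Real.pi / (2 * L) := by positivity
      linarith
    · rw [div_le_div_iff₀ (by positivity) (by norm_num)]; nlinarith
  nlinarith [mul_nonneg hA hB]

/-- the pairing step, descending half: `sin(π(j+1)/L) ≤ sin(πj/L)` when `L ≤ 2j + 1` and `j + 1 ≤ L`. [folklore] -/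
theorem screen_sin_step_ge {L j : ℕ} (h : L ≤ 2 * j + 1) (hjL : j + 1 ≤ L) :
    Real.sin (Real.pi * (j + 1) / L) ≤ Real.sin (Real.pi * j / L) := by
  have hL' : (0 : ℝ) < L := by exact_mod_cast (show 0 < L by omega)
  have h' : (L : ℝ) ≤ 2 * j + 1 := by exact_mod_cast h
  have hjL' : (j : ℝ) + 1 ≤ L := by exact_mod_cast hjL
  have hpi := Real.pi_pos
  have hs := Real.sin_sub_sin (Real.pi * (j + 1) / L) (Real.pi * j / L)
  have e1 : (Real.pi * (j + 1) / L - Real.pi * j / L) / 2 = Real.pi / (2 * L) := by field_simp; ring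
  have e2 : (Real.pi * (j + 1) / L + Real.pi * j / L) / 2 = (2 * j + 1) * Real.pi / (2 * L) := by field_simp; ring
  rw [e1, e2] at hs
  have hA : 0 ≤ Real.sin (Real.pi / (2 * L)) := by
    apply Real.sin_nonneg_of_nonneg_of_le_pi
    · positivity
    · rw [div_le_iff₀ (by positivity)]; nlinarith
  have hB : Real.cos ((2 * j + 1) * Real.pi / (2 * L)) ≤ 0 := by
    apply Real.cos_nonpos_of_pi_div_two_le_of_le
    · rw [div_le_div_iff₀ (by norm_num) (by positivity)]; nlinarith
    · rw [div_le_iff₀ (by positivity)]; nlinarith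
  nlinarith [mul_nonpos_iff.mpr (Or.inl ⟨hA, hB⟩)]

/-- pairing, ascending half: `c·S_j ≤ P_j` when `2j + 1 ≤ L`. [folklore] -/
theorem screenP_ge_left {L j : ℕ} (hL : 2 ≤ L) (h : 2 * j + 1 ≤ L) :
    Real.cos (Real.pi / L) * screenS L j ≤ screenP L j := by
  rw [screenS_eq_sin, screenP_eq_sin]
  have hc := screen_cos_nonneg hL
  have hs0 : 0 ≤ Real.sin (Real.pi * j / L) := screen_sin_nonneg (by omega)
  have hstep := screen_sin_step_le (by omega) h
  have : Real.sin (Real.pi * j / L) ^ 2 ≤ Real.sin (Real.pi * j / L) * Real.sin (Real.pi * (j + 1) / L) := by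
    rw [sq]; exact mul_le_mul_of_nonneg_left hstep hs0
  nlinarith [mul_nonneg hc hs0]

/-- pairing, descending half: `c·S_{j+1} ≤ P_j` when `L ≤ 2j + 1`, `j + 1 ≤ L`. [folklore] -/
theorem screenP_ge_right {L j : ℕ} (hL : 2 ≤ L) (h : L ≤ 2 * j + 1) (hjL : j + 1 ≤ L) :
    Real.cos (Real.pi / L) * screenS L (j + 1) ≤ screenP L j := by
  rw [screenS_eq_sin, screenP_eq_sin]
  have hc := screen_cos_nonneg (L := L) hL
  have hs1 : 0 ≤ Real.sin (Real.pi * (j + 1) / L) := by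
    have := screen_sin_nonneg (L := L) (j := j + 1) hjL
    push_cast at this; exact this
  have hstep := screen_sin_step_ge h hjL
  have e : ((j + 1 : ℕ) : ℝ) = (j : ℝ) + 1 := by push_cast; ring
  rw [e]
  have : Real.sin (Real.pi * (j + 1) / L) ^ 2 ≤ Real.sin (Real.pi * j / L) * Real.sin (Real.pi * (j + 1) / L) := by
    rw [sq]; exact mul_le_mul_of_nonneg_right hstep hs1
  nlinarith [mul_nonneg hc hs1]

/-- the termwise screening bound: for `0 < τ`, `0 < m ≤ x`, `0 ≤ l`, `τ < l·m`:
`1/(l x − τ) ≤ (m/(l m − τ))·(1/x)`. [folklore] -/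
theorem screen_inv_sub_le {l m x τ : ℝ} (hτ : 0 ≤ τ) (hm : 0 < m) (hmx : m ≤ x) (hl : 0 ≤ l) (hlm : τ < l * m) :
    (l * x - τ)⁻¹ ≤ m / (l * m - τ) * x⁻¹ := by
  have hx : 0 < x := lt_of_lt_of_le hm hmx
  have hlx : 0 < l * x - τ := by nlinarith
  have hden : 0 < l * m - τ := by linarith
  have key : (l * m - τ) * x ≤ m * (l * x - τ) := by nlinarith
  calc (l * x - τ)⁻¹ = 1 / (l * x - τ) := inv_eq_one_div _
    _ ≤ m / ((l * m - τ) * x) := by rw [div_le_div_iff₀ hlx (by positivity)]; linarith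
    _ = m / (l * m - τ) * x⁻¹ := by rw [div_mul_eq_div_div, div_eq_mul_inv]


/-! ## The two lattice sums as row sums (`L = n + 2`) -/

/-- summand of `L²·g₀(L;0)`. [folklore] -/
def screenF0 (L j k : ℕ) : ℝ := if j = 0 ∧ k = 0 then 0 else (screenS L j + screenS L k - 0)⁻¹

/-- summand of `L²·g₁(L;t)`. [folklore] -/
def screenF1 (L : ℕ) (t : ℝ) (j k : ℕ) : ℝ :=
  if (j = 0 ∨ j = L - 1) ∧ k = 0 then 0 else (screenP L j + screenS L k - t)⁻¹

/-- `G₀(L) := L²·g₀(L; 0) = Σ_j Σ_k screenF0`. [folklore] -/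
def screenG0 (L : ℕ) : ℝ := ∑ j ∈ Finset.range L, ∑ k ∈ Finset.range L, screenF0 L j k

/-- `G₁(L; t) := L²·g₁(L; t) = Σ_j Σ_k screenF1`. [folklore] -/
def screenG1 (L : ℕ) (t : ℝ) : ℝ := ∑ j ∈ Finset.range L, ∑ k ∈ Finset.range L, screenF1 L t j k

/-- `g₀(L; 0) = L⁻² · G₀(L)`. [folklore] -/
theorem gZero_zero_eq (L : ℕ) : gZero L 0 = ((L : ℝ) ^ 2)⁻¹ * screenG0 L := rfl

/-- `g₁(L; t) = L⁻² · G₁(L; t)`. [folklore] -/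
theorem gOne_eq (L : ℕ) (t : ℝ) : gOne L t = ((L : ℝ) ^ 2)⁻¹ * screenG1 L t := rfl

/-- [folklore] -/
theorem screenF0_zero_zero (L : ℕ) : screenF0 L 0 0 = 0 := by simp [screenF0]

/-- [folklore] -/
theorem screenF0_zero_succ (L k : ℕ) : screenF0 L 0 (k + 1) = (screenS L (k + 1))⁻¹ := by
  simp [screenF0, screenS_zero]

/-- [folklore] -/
theorem screenF0_succ (L j k : ℕ) : screenF0 L (j + 1) k = (screenS L (j + 1) + screenS L k)⁻¹ := by
  simp [screenF0]

/-- [folklore] -/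
theorem screenF1_zero_zero (L : ℕ) (t : ℝ) : screenF1 L t 0 0 = 0 := by simp [screenF1]

/-- [folklore] -/
theorem screenF1_zero_succ (L k : ℕ) (t : ℝ) : screenF1 L t 0 (k + 1) = (screenS L (k + 1) - t)⁻¹ := by
  simp [screenF1, screenP_zero]

/-- [folklore] -/
theorem screenF1_last_zero (n : ℕ) (t : ℝ) : screenF1 (n + 2) t (n + 1) 0 = 0 := by simp [screenF1]

/-- [folklore] -/
theorem screenF1_last_succ (n k : ℕ) (t : ℝ) : screenF1 (n + 2) t (n + 1) (k + 1) = (screenS (n + 2) (k + 1) - t)⁻¹ := by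
  simp [screenF1, screenP_last]

/-- [folklore] -/
theorem screenF1_mid {n i : ℕ} (hi : i < n) (t : ℝ) (k : ℕ) :
    screenF1 (n + 2) t (i + 1) k = (screenP (n + 2) (i + 1) + screenS (n + 2) k - t)⁻¹ := by
  have hne : ¬ ((i + 1 = 0 ∨ i + 1 = n + 2 - 1) ∧ k = 0) := by omega
  unfold screenF1
  rw [if_neg hne]

/-- `R = Σ_{k=1}^{L−1} 1/S_k`. [folklore] -/
def screenRowR (n : ℕ) : ℝ := ∑ k ∈ Finset.range (n + 1), (screenS (n + 2) (k + 1))⁻¹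

/-- `B_j = Σ_{k=1}^{L−1} 1/(S_j + S_k)`. [folklore] -/
def screenRowB (n j : ℕ) : ℝ := ∑ k ∈ Finset.range (n + 1), (screenS (n + 2) j + screenS (n + 2) (k + 1))⁻¹

/-- `R'(τ) = Σ_{k=1}^{L−1} 1/(S_k − τ)`. [folklore] -/
def screenRowRone (n : ℕ) (τ : ℝ) : ℝ := ∑ k ∈ Finset.range (n + 1), (screenS (n + 2) (k + 1) - τ)⁻¹

/-- `T_j(τ) = 1/(P_j − τ) + Σ_{k=1}^{L−1} 1/(P_j + S_k − τ)`. [folklore] -/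
def screenRowT (n : ℕ) (τ : ℝ) (j : ℕ) : ℝ :=
  (screenP (n + 2) j - τ)⁻¹ + ∑ k ∈ Finset.range (n + 1), (screenP (n + 2) j + screenS (n + 2) (k + 1) - τ)⁻¹

/-- `U_j(τ) = 1/(c·S_j − τ) + Σ_{k=1}^{L−1} 1/(c·S_j + S_k − τ)`, `c = cos(π/L)`. [folklore] -/
def screenRowU (n : ℕ) (τ : ℝ) (j : ℕ) : ℝ :=
  (Real.cos (Real.pi / (n + 2 : ℕ)) * screenS (n + 2) j - τ)⁻¹
    + ∑ k ∈ Finset.range (n + 1),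
        (Real.cos (Real.pi / (n + 2 : ℕ)) * screenS (n + 2) j + screenS (n + 2) (k + 1) - τ)⁻¹

/-- row decomposition of `G₀`: `G₀ = R + Σ_{j=1}^{L−1} (1/S_j + B_j)`. [folklore] -/
theorem screenG0_eq (n : ℕ) :
    screenG0 (n + 2) = screenRowR n + ∑ j ∈ Finset.range (n + 1), ((screenS (n + 2) (j + 1))⁻¹ + screenRowB n (j + 1)) := by
  unfold screenG0 screenRowR screenRowB
  rw [Finset.sum_range_succ']
  have row0 : ∑ k ∈ Finset.range (n + 2), screenF0 (n + 2) 0 k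
      = ∑ k ∈ Finset.range (n + 1), (screenS (n + 2) (k + 1))⁻¹ := by
    rw [Finset.sum_range_succ', screenF0_zero_zero, add_zero]
    exact Finset.sum_congr rfl (fun k _ => screenF0_zero_succ _ _)
  have rowj : ∀ j : ℕ, ∑ k ∈ Finset.range (n + 2), screenF0 (n + 2) (j + 1) k
      = (screenS (n + 2) (j + 1))⁻¹ + ∑ k ∈ Finset.range (n + 1), (screenS (n + 2) (j + 1) + screenS (n + 2) (k + 1))⁻¹ := by
    intro j
    rw [Finset.sum_range_succ', screenF0_succ, screenS_zero, add_zero, add_comm]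
    congr 1
    exact Finset.sum_congr rfl (fun k _ => screenF0_succ _ _ _)
  rw [row0, add_comm]
  congr 1
  exact Finset.sum_congr rfl (fun j _ => rowj j)

/-- row decomposition of `G₁`: `G₁(τ) = 2R'(τ) + Σ_{j=1}^{L−2} T_j(τ)`. [folklore] -/
theorem screenG1_eq (n : ℕ) (τ : ℝ) :
    screenG1 (n + 2) τ = 2 * screenRowRone n τ + ∑ i ∈ Finset.range n, screenRowT n τ (i + 1) := by
  unfold screenG1 screenRowRone screenRowT
  rw [Finset.sum_range_succ, Finset.sum_range_succ']
  have row0 : ∑ k ∈ Finset.range (n + 2), screenF1 (n + 2) τ 0 k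
      = ∑ k ∈ Finset.range (n + 1), (screenS (n + 2) (k + 1) - τ)⁻¹ := by
    rw [Finset.sum_range_succ', screenF1_zero_zero, add_zero]
    exact Finset.sum_congr rfl (fun k _ => screenF1_zero_succ _ _ _)
  have rowL : ∑ k ∈ Finset.range (n + 2), screenF1 (n + 2) τ (n + 1) k
      = ∑ k ∈ Finset.range (n + 1), (screenS (n + 2) (k + 1) - τ)⁻¹ := by
    rw [Finset.sum_range_succ', screenF1_last_zero, add_zero]
    exact Finset.sum_congr rfl (fun k _ => screenF1_last_succ _ _ _)
  have rowi : ∀ i ∈ Finset.range n, ∑ k ∈ Finset.range (n + 2), screenF1 (n + 2) τ (i + 1) k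
      = (screenP (n + 2) (i + 1) - τ)⁻¹
        + ∑ k ∈ Finset.range (n + 1), (screenP (n + 2) (i + 1) + screenS (n + 2) (k + 1) - τ)⁻¹ := by
    intro i hi
    have hi' : i < n := Finset.mem_range.mp hi
    rw [Finset.sum_range_succ', screenF1_mid hi', screenS_zero, add_zero, add_comm]
    congr 1
    exact Finset.sum_congr rfl (fun k _ => screenF1_mid hi' _ _)
  rw [row0, rowL, Finset.sum_congr rfl rowi]
  ring

end Summit.HubbardSuperconductivity.HubbardSuperconductivity.Theorems.AnisotropyChord.Transfer

end
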